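import Mathlib
import HarnessLib
import HarnessLib.Audit
import Summits.CriticalPhenomena.Statement
import Literature.Probability.Percolation.CardyFormula
import Literature.Probability.LatticeModels.TriangularLattice
import HarnessLib.Audit.Status.Attr

/-!
Route: CardyPerronTeleport

DORMANT since 2026-08-24T05:52:09Z (reconciler: no traction for 6.6 d (last activity item-evidence-added at 2026-08-17T15:25:11Z); parked, not closed — `ledger route dormant route-CriticalPhenomena-CardyPerronTeleport --off` to reactiva) — unstaffed, not closed; items shared with open routes are served there. `ledger route dormant <id> --off` reactivates.

# Route CardyPerronTeleport — Smirnov's half-strip boundary law is the common Perron vector of a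
commuting Izergin-Korepin family on Z^2 - Cardy on bond-Z^2 half-strips is one same-lattice step
away, and X_U closes

It suffices to show X = HalfStripCardyZ2 ∧ X_U. HalfStripCardyZ2 (rank-0 target, new): for all
fractions 0 ≤ ξ₀ < ξ₁ < ξ₂ < ξ₃ ≤ 1, the P_{1/2} bond-ℤ² probability that the bottom arcs [ξ₀N, ξ₁N]
and [ξ₂N, ξ₃N] of the discrete half-strip {0,…,N} × ℕ are joined by an open path inside the
half-strip tends, as N → ∞, to F(η(ξ)), F = cardyFunction and η the cross-ratio of xᵢ = −cos(πξᵢ) (w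
= −cos πz uniformises the half-strip {0<Re z<1, Im z>0} onto ℍ). X_U (imported crux, =
stmt-CriticalPhenomena-0745 of route CardyUniqueLimit): the bond-ℤ² crossing probabilities of ALL
conformal rectangles converge to some function of the cross-ratio. Given X, the conjunct follows
through the provable glue HalfStripRigidity (X pins the unknown function to F: every η ∈ (0,1) is a
half-strip modulus) — this replaces CardyUniqueLimit's SLE₆-based CardyRigidity by an exact anchor.
Card realised: ik-honeycomb-perron-teleport (spine). HalfStripCardyZ2 is attacked as
HalfStripUniversality (crux 2: bond-ℤ² and site-𝕋 half-strip end crossing probabilities have the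
same limit) + HalfStripCardyT (Smirnov on 𝕋 half-strips), and HalfStripUniversality through the
card's exact anchor PerronTeleport (crux 3, informal until the dilute-TL objects are defined): the
isotropic n=1 Izergin–Korepin 19-vertex model on the ℤ² half-strip carries EXACTLY the site-𝕋
half-strip end law at every finite width, because Garbali–Nienhuis's double-row transfer matrices
T_L(x) commute in x, are nonnegative on [π/3, 2π/3], and the x = π/3 member factorises into the
(herringbone) honeycomb = site percolation on 𝕋 with free walls; what is then left is ONE
same-lattice universality step (corner fugacity t: √3/2 → 0 on ℤ²'s cell grid, card
corner-fugacity-plane "Route 1").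
Lean: `(∀ ξ : Fin 4 → ℝ, StrictMono ξ → 0 ≤ ξ 0 → ξ 3 ≤ 1 → Filter.Tendsto (fun N : ℕ =>
(Literature.Probability.Percolation.bondPercolation (Literature.Probability.LatticeModels.zdGraph 2)
Literature.Probability.Percolation.half).real (Literature.Probability.Percolation.openCrossing {v :
Literature.Probability.LatticeModels.Site 2 | 0 ≤ v 0 ∧ v 0 ≤ (N : ℤ) ∧ 0 ≤ v 1} {v :
Literature.Probability.LatticeModels.Site 2 | v 1 = 0 ∧ ((⌊ξ 0 * (N : ℝ)⌋₊ : ℕ) : ℤ) ≤ v 0 ∧ v 0 ≤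
((⌊ξ 1 * (N : ℝ)⌋₊ : ℕ) : ℤ)} {v : Literature.Probability.LatticeModels.Site 2 | v 1 = 0 ∧ ((⌊ξ 2 *
(N : ℝ)⌋₊ : ℕ) : ℤ) ≤ v 0 ∧ v 0 ≤ ((⌊ξ 3 * (N : ℝ)⌋₊ : ℕ) : ℤ)})) Filter.atTop (nhds
(Literature.Probability.RandomPlanarGeometry.cardyFunction
(Literature.Probability.RandomPlanarGeometry.crossRatio (fun i => - Real.cos (Real.pi * ξ i)))))) ∧
(∃ f : ℝ → ℝ, ∀ R : Literature.Probability.RandomPlanarGeometry.ConformalRectangle,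
R.HasCrossingLimit (Literature.Probability.Percolation.bondDomainCrossingProb R) f)`

## Assembly
Pure logic plus one Tendsto.add, sorry-free in the planner sketch (Sketch2.lean, `assembly_proof`):
HalfStripUniversality and HalfStripCardyT (fed Smirnov's fact) give HalfStripCardyZ2 (P^ℤ² = (P^ℤ² −
P^𝕋) + P^𝕋 → 0 + F); HalfStripRigidity turns it into CardyRigidity; with X_U's f, for any R and
uniformizing (φ, x), η = crossRatio x ∈ (0,1)
(ConformalRectangle.crossRatio_mem_Ioo_of_isUniformizing), rewrite f η = F η. PerronTeleport (crux
3, filed informally after open) is the mechanism behind HalfStripUniversality and does not enter the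
formal assembly.

Rationale: WHY THIS LINE. Mechanism (arXiv:1411.7020 §2, eq. for T(t|z;ζ_l,ζ_r) and [T(t₁),T(t₂)] = 0; Nienhuis
1990 / BloteNienhuis1989 weights; arXiv:hep-th/9506074 §2 "honeycomb limit u = λ, ρ₉ → 0"): at λ =
π/3 (q³ = −1, loop weight n = 1, sin 3λ = 0) the IK R-matrix has, at spectral parameter x = π/3,
weights r₁=…=r₈ = 3/4, r₉ = 0 (checked numerically here), i.e. the 4-leg vertex splits into two
honeycomb vertices, and the reflecting K-matrix K^(1)(x, ζ=0) = cos x · (κ₃+κ₅) is x-INDEPENDENT up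
to a scalar (2cos λ = 1, 3λ/2 = π/2 — a second accident of λ = π/3, computed here from GN's printed
k₃, k₅), so the normalised double-row family T_L(x)/cos²x is a commuting family of nonnegative
matrices on dilute link patterns for x ∈ [π/3, 2π/3] whose common Perron vector is at once the
bottom-row connectivity law of the half-infinite honeycomb strip (site-𝕋 percolation, Smirnov's
model) and of the isotropic 19-vertex model (x = π/2: vacancy 1, straight 1, turn √3/2, pairings ½,
½). Geometry check done here: only DOUBLE-row (Sklyanin) matrices commute for open strips; their
rows alternate tilt ±θ(x) (herringbone), a pure vertical stretch macroscopically, to which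
half-strip END laws are blind — consistent with conformal invariance (a homogeneous single-row
family would shear the half-strip and could not share its end law). Imported area: Yang–Baxter
integrability / quantum inverse scattering (commuting transfer matrices, reflection equation,
Perron–Frobenius) used as an exact TRANSFER device for a theorem (Smirnov2001), not for a
Bethe-ansatz computation; plus the corner-fugacity interpolation on ℤ²'s cell grid for the residual
step. What prior routes do not do: CardyIsoradial transports inside the bond-isoradial star–triangle
class from an anchor where Cardy is OPEN; CardyUniqueLimit/CardyViaSLE6 identify the value F through
SLE₆ machinery; CardyHarmonicInvariants/CardyDiscreteHolo need a ℤ² observable. Here the value F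
reaches ℤ²'s own vertex set exactly, at finite size, by commuting two matrices, and the open content
is isolated as one typed universality statement on one family of quads (HalfStripUniversality) plus
X_U. Negatives index (stmt-0772, SAW): unrelated.

RANKED CRUXES. #0 HalfStripCardyZ2 (target) — Cardy's formula on half-strip ends for bond
percolation on ℤ² at p = 1/2: for 0 ≤ ξ₀<ξ₁<ξ₂<ξ₃ ≤ 1 the probability that the bottom arcs
[⌊ξ₀N⌋,⌊ξ₁N⌋] and [⌊ξ₂N⌋,⌊ξ₃N⌋] of {0..N}×ℕ are joined by an open path of the half-strip tends to
F(crossRatio(−cos πξᵢ)) as N → ∞ (card ik-honeycomb-perron-teleport, "HalfStripCardy for bond-ℤ²" =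
X_RS of the retired rs-qkz card / P1 of combinatorial-point-anchor). (why it might fail: It is Cardy
for bond-ℤ² on one quad family: false iff universality fails on ℤ² (LPSA94 / Ziff numerics agree
with F to ~1e-3); as typed, floors and the closed-strip convention move marks by O(1/N) only,
harmless by RSW continuity.) [Cardy1992, Smirnov2001, LanglandsPouliotSaintaubin1994,
arXiv:1411.7020, BollobasRiordan2006]
#2 HalfStripUniversality (crux) — Half-strip end universality between site-𝕋 and bond-ℤ²: for the
same fractions ξ, the bond-ℤ² half-strip probability of the target and the site-𝕋 (p = 1/2,
triGraph, free walls) probability that the bottom arcs [⌊ξ₀N⌋,⌊ξ₁N⌋], [⌊ξ₂N⌋,⌊ξ₃N⌋] of the 𝕋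
half-strip {0 ≤ Re ≤ N, Im ≥ 0} = {v | 0 ≤ v₁, 0 ≤ 2v₀+v₁ ≤ 2N} are joined by open sites inside it
differ by o(1) as N → ∞. Intended proof = the card's chain: PerronTeleport (exact, crux 3) makes the
site-𝕋 number equal, at every finite N, to that of the isotropic IK 19-vertex model =
corner-fugacity model M(√3/2, ½) on ℤ²'s cell grid; then CornerIrrelevance along t ∈ [0, √3/2] at b
= ½ and the freezing identification M(0,½) = bond-ℤ² on a renewal grid (card corner-fugacity-plane
F2/F4) — foreseen layer-2 children, not filed now. [difficulty: open-problem] (why it might fail: It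
is site-𝕋↔bond-ℤ² universality on one quad family; no proof technology yet: the intended chain needs
CornerIrrelevance in t whose t→0 end is singular (one corner = XOR with a quadrant, refuter flag on
corner-fugacity-plane) and RSW without FKG for 0<t<√3/2.) [arXiv:1411.7020, arXiv:hep-th/9506074,
Beffara2008Universal, LanglandsPouliotSaintaubin1994, BloteNienhuis1989,
lean:Literature.Barriers.CriticalPhenomena.CoveringLatticeShift]
#4 UniqueConformalLimit (crux) — X_U (verbatim the target CardyUniqueLimitThesis of route
CardyUniqueLimit, stmt-CriticalPhenomena-0745, shared): there is one f : ℝ → ℝ such that for every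
conformal rectangle R the bond-ℤ² crossing probability converges to f(η(R)) (existence + conformal
invariance, value unspecified). Imported, not attacked here (sibling routes CardyRotToConf /
CardyViaSLE6 / CardyHarmonicInvariants carry it); this route supplies the VALUE. [difficulty:
open-problem] (why it might fail: X_U = Aizenman/LPSA hypothesis for bond-ℤ², open
(BollobasRiordan2006 Ch7 Conj 1); proved only on 𝕋 (Smirnov2001). Fails if subsequential limits are
non-unique or only similarity-, not Möbius-invariant; EmbeddingModulusUniqueness: no embedding-blind
proof (Beffara2008 Prop 4).) [BollobasRiordan2006, arXiv:math/9401222, arXiv:0708.3908,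
Schramm2007ICM, lean:Literature.Barriers.CriticalPhenomena.EmbeddingModulusUniqueness]
#9 HalfStripCardyT (support) — Smirnov ⇒ half-strip Cardy on 𝕋: assuming the Literature fact
hasCrossingLimit_triDomainCrossingProb (Smirnov2001 Thm 1, every bounded Jordan conformal
rectangle), the site-𝕋 half-strip end crossing probability of HalfStripUniversality tends to
F(crossRatio(−cos πξᵢ)). Proof: exhaust the half-strip by the Jordan sub-domains D_ρ = {z : |cos πz|
< ρ} (images of half-discs, explicit uniformising maps −(s/ρ + ρ/s) ∘ (−cos πz), so their
cross-ratios → η(ξ) as ρ → ∞), truncation error ≤ P[open path from the bottom to height ~ log ρ] ≤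
e^(−cK) uniformly in N (tri_rsw_half_holds, proved), G02 discretisation vs explicit lattice sets
differ by O(1/N) boundary shifts (RSW continuity), continuity of F on (0,1)
(continuousOn_cardyFunction_Ioo, proved). [difficulty: L] [Smirnov2001,
Smirnov2009CriticalPercolation, Werner2007, Kesten1982,
lean:Literature.Probability.Percolation.tri_rsw_half_holds]
#9 HalfStripRigidity (support) — Half-strip Cardy pins the value: HalfStripCardyZ2 → CardyRigidity
(verbatim crux r2 of CardyUniqueLimit, stmt-0746, as CONCLUSION): if all bond-ℤ² conformal
rectangles converge to f(cross-ratio) then f = F on (0,1). Proof: for η ∈ (0,1) and the exhausting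
Jordan domains D_ρ ⊂ half-strip with bottom marks ξ^(ρ) chosen so that crossRatio = η exactly
(intermediate value; explicit maps as in HalfStripCardyT), f(η) = lim_δ P_(D_ρ)(δ) along δ = 1/N is
within e^(−cK(ρ)) (rsw_half_holds, proved) + o(1) of the half-strip limit F(η_∞(ξ^(ρ))) → F(η)
(continuity of F). Elementary but needs explicit ConformalRectangle structures on D_ρ and
G02-discretisation bookkeeping. [difficulty: L] [Werner2007, BollobasRiordan2006,
lean:Literature.Probability.Percolation.rsw_half_holds,
lean:Literature.Probability.RandomPlanarGeometry.continuousOn_cardyFunction_Ioo]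

TWO-LAYER PLAN. Foreseen glued split of HalfStripUniversality once PerronTeleport is typed and
closes (k = 3, depth 1): HalfStripUniversality ⇐ PerronTeleport (∀ L, arcs I,J: P^(IK(π/2), free
walls)_L[I ↔ J through the half-strip] = P^(herringbone-honeycomb site-𝕋, free)_L[I ↔ J], exact) →
HerringboneToRegular (the herringbone strip and the regular 𝕋 half-strip differ by one wall hexagon
every other row: o(1) by boundary-pivotality/RSW) → CornerIrrelevanceHalfStrip (half-strip end
crossing limits of the corner-fugacity models M(t,½), t ∈ [0, √3/2], agree, and M(0,½) = bond-ℤ² on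
a renewal grid is harmless) → HalfStripUniversality. PerronTeleport itself, if split:
CommutingNonnegFamily (YBE + reflection equation for K = κ₃+κ₅ at λ = π/3; entrywise ≥ 0 on
[π/3,2π/3]; primitivity on lp_L) → PerronIsEndLaw (M → ∞ limit of finite strips forgets the top
state) → HoneycombDictionary (x = π/3 double rows = herringbone honeycomb with reflecting walls;
reflecting loops = iid interior colouring + independent fair outer-wall colours; free crossing
probability = 2·P[link-pattern event B: I ↔ J and right outer face of the other colour]).

KILL CRITERIA. ¬HalfStripCardyZ2 (a half-strip family on which bond-ℤ² provably converges to
something ≠ F, or has two cluster points) refutes CardyFormulaZ2 itself — report, close every Cardy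
route. ¬HalfStripUniversality likewise (given Smirnov). ¬X_U refutes the conjunct. The ROUTE (not
the conjunct) dies if PerronTeleport is refuted in typed form: e.g. the x = π/3 double row with K =
κ₃+κ₅ is NOT the free/reflecting honeycomb wall (boundary dictionary wrong and unrepairable for
every integrable K), or T_L(π/2) is not primitive on lp_L — then close `refuted:PerronTeleport`
unless the cylinder version (periodic single-row family, no K-matrix; exact but not a planar ℤ²
domain) can be re-assembled; if only CornerIrrelevance stalls, the route goes dormant with the exact
IK-anchor theorem as its deliverable. Proved elsewhere: CardyRigidity (CardyUniqueLimit r2) + X_U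
moots the assembly but not HalfStripCardyZ2's independent interest; CardyFormulaZ2 by any route
moots everything.

NOT DECOMPOSED YET. CornerIrrelevanceHalfStrip (the genuine universality residue: needs the
corner-fugacity family M(t,b) defined, RSW without FKG for 0 < t < √3/2, and a mechanism — none
filed until PerronTeleport is typed); the boundary K-matrix dictionary and primitivity inside
PerronTeleport; the G02-discretisation and explicit-uniformisation bookkeeping inside the two
supports (provers attach lemmas with --supports); the Rosetta half (b) of the card (asymptotics of
GN's qKZ ground state vs the Beta/Cardy lamination law) — a benchmark, deliberately not an item; the
periodic (cylinder) variant of the teleport.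

CHEAPEST FALSIFIER. Build GN's double-row transfer matrix (arXiv:1411.7020 §2.2, homogeneous zᵢ = 1,
n = n₀ = 1, λ = π/3, K = κ₃+κ₅ both walls) on dilute link patterns for L ≤ 7 at x = π/2 and x = π/3
(kit compute, exact rational/algebraic arithmetic): check entrywise nonnegativity, primitivity, and
that the two Perron vectors coincide to machine precision; then compare 2·P[B] read off the x = π/3
Perron vector with brute-force free site-percolation crossing probabilities of the herringbone
honeycomb half-strip truncated at height M ≈ 3L (exact enumeration / transfer over colourings). Any
mismatch kills PerronTeleport as stated (most likely place: the wall dictionary). Done here by hand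
only: bulk weights at x = π/3 (r₁..r₈ = 3/4, r₉ = 0), x = π/2 (√3/2, 1, 1, ½, ½), x ↦ π−x swaps
r₈↔r₉ (crossing symmetry = 90° rotation), and K^(1)(x,0) = cos x·(κ₃+κ₅) from GN's printed k₃, k₅ —
all consistent.

NUMBERS. Reference values of the target (this session, F via its ₂F₁ series): ξ = (0,1/3,2/3,1): η =
1/9, F = 0.277453; ξ = (0,1/4,3/4,1): η = 0.029437, F = 0.175647; ξ = (0,1/2,3/4,1): η = 0.171573, F
= 0.324353; ξ = (0,0.49,0.51,1): η = 0.881893, F = 0.716479. IK weights at λ = π/3: x = π/3 →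
(3/4)×8, r₉ = 0; x = π/2 → turns √3/2, straight/vacancy 1, pairings ½,½; nonnegative on [π/3, 2π/3].
Reflecting K at ζ = 0: k₃ = k₅ = cos x, k₁ = k₂ = k₄ = 0. Items at open: 6 typed (target, 2 cruxes,
2 supports, assembly) + PerronTeleport (crux 3, informal) + 2 definition requests.

DEFINITION REQUESTS. (1) DiluteLinkPattern L (GN's lp_L: occupations nᵢ ∈ {−1,0,1} / non-crossing
partial pairings with wall attachments) with the plaquette operators ρ^(1..9), κ^(1..5) and the
double-row transfer matrix T_L(x; ζ_l, ζ_r) of arXiv:1411.7020 §2 at n = n₀ = 1, λ = π/3, as a real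
matrix — topic Literature/Probability/LatticeModels (integrable loop models); (2) the herringbone
honeycomb half-strip as a region of triGraph's dual / of ℤ², its free site-percolation measure, and
the domain-wall map site-configuration ↦ bottom link pattern; the isotropic IK (= corner-fugacity
M(√3/2,½)) half-strip Gibbs measure on cell colourings and its bottom law — topic
Summits/CriticalPhenomena/CardyFormulaZ2/Theorems or Literature/Probability/LatticeModels. Both
filed with `ledger workitem add --kind definition --for <PerronTeleport>` right after open. Facts
wanted later (cite items, not load-bearing now): YBE for the IK Ř at q³ = −1 and the reflection
equation for K^(1) (arXiv:1411.7020 §2.1–2.2; provable by computation once defined).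

Novelty: Searches (2026-08-15, this seat; remote APIs mostly rate-limited, logged in NOTES): `lit search
--hybrid "dilute loop model transfer matrix ground state site percolation half strip Cardy"` (8 book
hits: Grimmett RCM, Bollobás–Riordan, Cardy 1996 …, none on IK/dTL); `lit search --source zbmath
"dilute Temperley-Lieb loop model open boundary ground state"` (1: arXiv:1411.7020 = GN, JSTAT
2017); `lit search --source arxiv|openalex|s2 …` (HTTP 429); `lit galaxy search "dilute loop model
percolation Cardy" --star all` and `"Izergin-Korepin" --star all` (galaxyd saturated, >90 s); `lit
read arxiv:1411.7020` pp. 3–5, 11 (link patterns with wall attachments, K^(1) weights, T(t|z;ζ)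
double-row operator, [T(t₁),T(t₂)] = 0, "dTL at n=1 is related to critical site percolation", closed
= ζ → 0); `lit read arxiv:hep-th/9506074` pp. 3–4, 6 (honeycomb limit u = λ, ρ₉ → 0, "pulled apart
horizontally", second limit ρ₈ → 0 "pulled apart vertically", t_O = 2cos λ; built on Sklyanin +
Destri–de Vega alternating inhomogeneities, i.e. a diagonal-to-diagonal matrix, NOT a commuting
family in u); the card's and the two refuter audits' searches (all 24+ cards, barrier files,
Manolescu arXiv:2502.08394 Rem. 5.6). `ledger negatives`: 1 entry (SAW), unrelated.
Nearest prior art found: arXiv:1411.7020 (Garbali–Nienhuis: the commuting double-row dTL family at n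
= 1, its polynomial ground state; percolation mentioned, no Cardy/Smirnov, no shared-eigenvector
transfer between x = π/3 and x = π/2); arXiv:hep-t  [refs: 1411.7020, hep-th/9506074, 2502.08394, hep-th/9410042, arxiv:1411.7020, arxiv:hep-th/9506074, BloteNienhuis1989]

Barriers (technique_class: yang-baxter commuting-transfer izergin-korepin anchor): - technique_class: yang-baxter commuting-transfer izergin-korepin anchor
- Literature.Barriers.CriticalPhenomena.SmirnovTriangularOnly: evaded — Smirnov's colour-switching
argument is never run off 𝕋; his theorem enters only as the hypothesis
hasCrossingLimit_triDomainCrossingProb inside HalfStripCardyT and the Assembly, and the square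
lattice receives the RESULT through a linear-algebra identity (PerronTeleport) plus a universality
statement (HalfStripUniversality) that uses no discrete holomorphicity.
- Literature.Barriers.CriticalPhenomena.EmbeddingModulusUniqueness: applies to the imported crux
UniqueConformalLimit (X_U), which the barrier's `blocks` field names; this route does not attack X_U
and concedes that any proof of it needs an embedding-specific input (evasions (i)/(ii)). NOT
applicable to HalfStripCardyZ2 / HalfStripUniversality / HalfStripRigidity: half-strip END laws are
blind to vertical stretching (the one-parameter shear-free family diag(1,p)·ℤ² shares them — exactly
why a commuting family CAN have an x-independent Perron vector), so no modulus is being identified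
there; the isotropic point x = π/2 is pinned by the weights (integrable input, evasion (ii)), and
HalfStripRigidity carries X_U's embedding-specific symmetry in its hypothesis (same exemption the
barrier grants CardyRigidity).
- Literature.Barriers.CriticalPhenomena.CoveringLatticeShift: does not touch the exact anchor or the
supports; it DOES bear on the foreseen child CornerIrrelevanceHalfStrip

History (route lifecycle, newest last):
- 2026-08-15T16:12:46Z · rev 1: dropped stmt-CriticalPhenomena-6143 — route-repair (glue): deciding theorem closes : HalfStripCardyZ2 → UniqueConformalLimit → HalfStripRigidity → CardyFormulaZ2 (X = target ∧ X_U decides the conjun (planner-rbadge-CriticalPhenomena-CardyPerronTe-83f36529-g4-0)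
- 2026-08-16T03:19:49Z · rev 4: dropped HalfStripGlue — route-choice follow-up: drop stmt-CriticalPhenomena-14122 (HalfStripGlue at rank 9) ONLY to re-file the identical glue at rank 10 — the gate renders supports by (planner-rchoice-CriticalPhenomena-CardyPerronT-2467bac4-0)
- 2026-08-16T03:50:10Z · AUTO-CRUX (backfill): HalfStripCardyZ2 — hypotheses of the deciding theorem that nothing in the route derives are cruxes (operator:999:586464)
- 2026-08-24T05:52:09Z · DORMANT — reconciler: no traction for 6.6 d (last activity item-evidence-added at 2026-08-17T15:25:11Z); parked, not closed — `ledger route dormant route-CriticalPhenomen (operator:999:3485338)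

sub-problem: CardyFormulaZ2 · status: dormant · opened planner-plancard-CriticalPhenomena-CardyFormu-570e0fce-0 2026-08-15T11:40:16Z · rev 5 · ledger route-CriticalPhenomena-CardyPerronTeleport
GENERATED by the gate from the ledger (D-0016/17). Provers cite these decls: `theorem foo : Summit.CriticalPhenomena.CardyFormulaZ2.Theses.CardyPerronTeleport.<Decl> := …` in Summits/CriticalPhenomena/CardyFormulaZ2/Theorems/<Name>.lean.
-/

namespace Summit.CriticalPhenomena.CardyFormulaZ2.Theses.CardyPerronTeleport

open scoped BigOperators Topology Manifold Classical MeasureTheory ProbabilityTheory Matrix InnerProductSpace ComplexConjugate ContinuousMap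
open Filter Set Function TopologicalSpace MeasureTheory

attribute [summit_statement] _root_.CardyFormulaZ2

/-- item stmt-CriticalPhenomena-5178 · crux (kind.auto-crux: conjecture-grade) · rank 0 · open · by planner
why it might fail: It is Cardy for bond-ℤ² on one quad family — open (Grimmett2018 §5.7 p.176; known only on site-𝕋, Smirnov2001): false iff ℤ² universality fails (LPSA94/Ziff numerics agree with F to ~1e-3); as typed, floors and the closed-strip convention move marks by O(1/N) only, harmless by RSW continuity.
sources: Cardy1992, Smirnov2001, LanglandsPouliotSaintaubin1994, Grimmett2018, BollobasRiordan2006, arXiv:1411.7020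
[target] Cardy's formula on half-strip ends for bond percolation on ℤ² at p = 1/2: for 0 ≤
ξ₀<ξ₁<ξ₂<ξ₃ ≤ 1 the probability that the bottom arcs [⌊ξ₀N⌋,⌊ξ₁N⌋] and [⌊ξ₂N⌋,⌊ξ₃N⌋] of {0..N}×ℕ are
joined by an open path of the half-strip tends to F(crossRatio(−cos πξᵢ)) as N → ∞ (card
ik-honeycomb-perron-teleport, "HalfStripCardy for bond-ℤ²" = X_RS of the retired rs-qkz card / P1 of
combinatorial-point-anchor). -/
@[route_item "route-CriticalPhenomena-CardyPerronTeleport", crux]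
def HalfStripCardyZ2 : Prop :=
  ∀ ξ : Fin 4 → ℝ, StrictMono ξ → 0 ≤ ξ 0 → ξ 3 ≤ 1 → Filter.Tendsto (fun N : ℕ => (Literature.Probability.Percolation.bondPercolation (Literature.Probability.LatticeModels.zdGraph 2) Literature.Probability.Percolation.half).real (Literature.Probability.Percolation.openCrossing {v : Literature.Probability.LatticeModels.Site 2 | 0 ≤ v 0 ∧ v 0 ≤ (N : ℤ) ∧ 0 ≤ v 1} {v : Literature.Probability.LatticeModels.Site 2 | v 1 = 0 ∧ ((⌊ξ 0 * (N : ℝ)⌋₊ : ℕ) : ℤ) ≤ v 0 ∧ v 0 ≤ ((⌊ξ 1 * (N : ℝ)⌋₊ : ℕ) : ℤ)} {v : Literature.Probability.LatticeModels.Site 2 | v 1 = 0 ∧ ((⌊ξ 2 * (N : ℝ)⌋₊ : ℕ) : ℤ) ≤ v 0 ∧ v 0 ≤ ((⌊ξ 3 * (N : ℝ)⌋₊ : ℕ) : ℤ)})) Filter.atTop (nhds (Literature.Probability.RandomPlanarGeometry.cardyFunction (Literature.Probability.RandomPlanarGeometry.crossRatio (fun i => - Real.cos (Real.pi * ξ 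i)))))

/-- item stmt-CriticalPhenomena-5179 · crux · rank 2 · open · by planner
why it might fail: Site-𝕋↔bond-ℤ² crossing universality is open even on one quad family: star-triangle transport never leaves the bond-isoradial class (arXiv:2502.08394 Rem 5.6) and site-𝕋 is outside it; the intended corner-fugacity interpolation needs RSW without FKG for 0<t<√3/2 and is singular at t→0.
sources: Beffara2008Universal, arXiv:2502.08394, Grimmett2018, BollobasRiordan2006, arXiv:1411.7020, arXiv:hep-th/9506074
[crux] Half-strip end universality between site-𝕋 and bond-ℤ²: for the same fractions ξ, the bond-ℤ²
half-strip probability of the target and the site-𝕋 (p = 1/2, triGraph, free walls) probability that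
the bottom arcs [⌊ξ₀N⌋,⌊ξ₁N⌋], [⌊ξ₂N⌋,⌊ξ₃N⌋] of the 𝕋 half-strip {0 ≤ Re ≤ N, Im ≥ 0} = {v | 0 ≤ v₁,
0 ≤ 2v₀+v₁ ≤ 2N} are joined by open sites inside it differ by o(1) as N → ∞. Intended proof = the
card's chain: PerronTeleport (exact, crux 3) makes the site-𝕋 number equal, at every finite N, to
that of the isotropic IK 19-vertex model = corner-fugacity model M(√3/2, ½) on ℤ²'s cell grid; then
CornerIrrelevance along t ∈ [0, √3/2] at b = ½ and the freezing identification M(0,½) = bond-ℤ² on a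
renewal grid (card corner-fugacity-plane F2/F4) — foreseen layer-2 children, not filed now.
[difficulty: open-problem] -/
@[route_item "route-CriticalPhenomena-CardyPerronTeleport"]
def HalfStripUniversality : Prop :=
  ∀ ξ : Fin 4 → ℝ, StrictMono ξ → 0 ≤ ξ 0 → ξ 3 ≤ 1 → Filter.Tendsto (fun N : ℕ => (Literature.Probability.Percolation.bondPercolation (Literature.Probability.LatticeModels.zdGraph 2) Literature.Probability.Percolation.half).real (Literature.Probability.Percolation.openCrossing {v : Literature.Probability.LatticeModels.Site 2 | 0 ≤ v 0 ∧ v 0 ≤ (N : ℤ) ∧ 0 ≤ v 1} {v : Literature.Probability.LatticeModels.Site 2 | v 1 = 0 ∧ ((⌊ξ 0 * (N : ℝ)⌋₊ : ℕ) : ℤ) ≤ v 0 ∧ v 0 ≤ ((⌊ξ 1 * (N : ℝ)⌋₊ : ℕ) : ℤ)} {v : Literature.Probability.LatticeModels.Site 2 | v 1 = 0 ∧ ((⌊ξ 2 * (N : ℝ)⌋₊ : ℕ) : ℤ) ≤ v 0 ∧ v 0 ≤ ((⌊ξ 3 * (N : ℝ)⌋₊ : ℕ) : ℤ)}) - (Literature.Probability.LatticeModels.triSitePercolation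 Literature.Probability.Percolation.half).real {ω : Literature.Probability.Percolation.SiteConfig (Literature.Probability.LatticeModels.Site 2) | ∃ x ∈ {v : Literature.Probability.LatticeModels.Site 2 | v 1 = 0 ∧ ((⌊ξ 0 * (N : ℝ)⌋₊ : ℕ) : ℤ) ≤ v 0 ∧ v 0 ≤ ((⌊ξ 1 * (N : ℝ)⌋₊ : ℕ) : ℤ)}, ∃ y ∈ {v : Literature.Probability.LatticeModels.Site 2 | v 1 = 0 ∧ ((⌊ξ 2 * (N : ℝ)⌋₊ : ℕ) : ℤ) ≤ v 0 ∧ v 0 ≤ ((⌊ξ 3 * (N : ℝ)⌋₊ : ℕ) : ℤ)}, ω ∈ Literature.Probability.Percolation.siteConnIn Literature.Probability.LatticeModels.triGraph {v : Literature.Probability.LatticeModels.Site 2 | 0 ≤ v 1 ∧ 0 ≤ 2 * v 0 + v 1 ∧ 2 * v 0 + v 1 ≤ 2 * (N : ℤ)} x y}) Filter.atTop (nhds 0)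

-- item stmt-CriticalPhenomena-6073 · crux · rank 3 · open · by planner — informal only, no Lean statement yet:
--   [crux] PerronTeleport (rank 3; card ik-honeycomb-perron-teleport half (a); informal until
--   DiluteLinkPattern / the IK double-row transfer matrix / the honeycomb domain-wall map are defined —
--   definition items filed --for this item). STATEMENT: fix λ = π/3, n = n₀ = 1, and for L ≥ 1 let
--   T_L(x) := cos(x)^(-2) · Tr( R_1(x)⋯R_L(x) K_r R_L(x̄)⋯R_1(x̄) K_l ) be Garbali–Nienhuis's
--   homogeneous (z_i = 1) double-row transfer operator on dilute link patterns lp_L (arXiv:1411.7020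
--   §2.1–2.2, eqs. for Ř weights r_1..r_9 and T(t|z;ζ_l,ζ_r)) with the REFLECTING boundary K_l = K_r =
--   κ₃ + κ₅ (= K^(1)(x, ζ = 0)/co

/-- item stmt-CriticalPhenomena-0745 · crux · rank 4 · open · by planner
why it might fail: X_U = Aizenman/LPSA hypothesis for bond-ℤ², open (BollobasRiordan2006 Ch7 Conj 1; by 2025 only rotation invariance, arXiv:2012.11672); proved only on 𝕋 (Smirnov2001). Fails if subsequential limits are non-unique or only similarity- not Möbius-invariant; no embedding-blind proof (Beffara2008 Prop 4).
sources: BollobasRiordan2006, arXiv:math/9401222, arXiv:0708.3908, Schramm2007ICM, arXiv:2012.11672, arXiv:2502.08394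
[target] X_U: bond-Z^2 crossing probabilities at p=1/2 have a scaling limit depending on the
conformal rectangle only through its cross-ratio: one f : ℝ → ℝ with bondDomainCrossingProb R δ →
f(η(R)) for every R (existence + conformal invariance, value unspecified). Smirnov2001 Thm 1 gives
this with f = F on the triangular lattice. -/
@[route_item "route-CriticalPhenomena-CardyPerronTeleport", crux]
def UniqueConformalLimit : Prop :=
  ∃ f : ℝ → ℝ, ∀ R : Literature.Probability.RandomPlanarGeometry.ConformalRectangle, R.HasCrossingLimit (Literature.Probability.Percolation.bondDomainCrossingProb R) f

/-- item stmt-CriticalPhenomena-5180 · support · rank 9 · open · by planner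
sources: Smirnov2001, Smirnov2009CriticalPercolation, Werner2007, Kesten1982, lean:Literature.Probability.Percolation.tri_rsw_half_holds, lean:Literature.Probability.Percolation.hasCrossingLimit_triDomainCrossingProb_holds
[support] Smirnov ⇒ half-strip Cardy on 𝕋: assuming the Literature fact
hasCrossingLimit_triDomainCrossingProb (Smirnov2001 Thm 1, every bounded Jordan conformal
rectangle), the site-𝕋 half-strip end crossing probability of HalfStripUniversality tends to
F(crossRatio(−cos πξᵢ)). Proof: exhaust the half-strip by the Jordan sub-domains D_ρ = {z : |cos πz|
< ρ} (images of half-discs, explicit uniformising maps −(s/ρ + ρ/s) ∘ (−cos πz), so their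
cross-ratios → η(ξ) as ρ → ∞), truncation error ≤ P[open path from the bottom to height ~ log ρ] ≤
e^(−cK) uniformly in N (tri_rsw_half_holds, proved), G02 discretisation vs explicit lattice sets
differ by O(1/N) boundary shifts (RSW continuity), continuity of F on (0,1)
(continuousOn_cardyFunction_Ioo, proved). [difficulty: L] -/
@[route_item "route-CriticalPhenomena-CardyPerronTeleport"]
def HalfStripCardyT : Prop :=
  Literature.Probability.Percolation.hasCrossingLimit_triDomainCrossingProb → ∀ ξ : Fin 4 → ℝ, StrictMono ξ → 0 ≤ ξ 0 → ξ 3 ≤ 1 → Filter.Tendsto (fun N : ℕ => (Literature.Probability.LatticeModels.triSitePercolation Literature.Probability.Percolation.half).real {ω : Literature.Probability.Percolation.SiteConfig (Literature.Probability.LatticeModels.Site 2) | ∃ x ∈ {v : Literature.Probability.LatticeModels.Site 2 | v 1 = 0 ∧ ((⌊ξ 0 * (N : ℝ)⌋₊ : ℕ) : ℤ) ≤ v 0 ∧ v 0 ≤ ((⌊ξ 1 * (N : ℝ)⌋₊ : ℕ) : ℤ)}, ∃ y ∈ {v : Literature.Probability.LatticeModels.Site 2 | v 1 = 0 ∧ ((⌊ξ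 2 * (N : ℝ)⌋₊ : ℕ) : ℤ) ≤ v 0 ∧ v 0 ≤ ((⌊ξ 3 * (N : ℝ)⌋₊ : ℕ) : ℤ)}, ω ∈ Literature.Probability.Percolation.siteConnIn Literature.Probability.LatticeModels.triGraph {v : Literature.Probability.LatticeModels.Site 2 | 0 ≤ v 1 ∧ 0 ≤ 2 * v 0 + v 1 ∧ 2 * v 0 + v 1 ≤ 2 * (N : ℤ)} x y}) Filter.atTop (nhds (Literature.Probability.RandomPlanarGeometry.cardyFunction (Literature.Probability.RandomPlanarGeometry.crossRatio (fun i => - Real.cos (Real.pi * ξ i)))))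

/-- item stmt-CriticalPhenomena-5181 · support · rank 9 · closed · proved by Summit.CriticalPhenomena.CardyFormulaZ2.Cruxes.HalfPlaneMarkDensityLaw.SketchLine.halfStripRigidity (prover) · by planner
sources: Werner2007, BollobasRiordan2006, lean:Literature.Probability.Percolation.rsw_half_holds, lean:Literature.Probability.RandomPlanarGeometry.continuousOn_cardyFunction_Ioo
[support] Half-strip Cardy pins the value: HalfStripCardyZ2 → CardyRigidity (verbatim crux r2 of
CardyUniqueLimit, stmt-0746, as CONCLUSION): if all bond-ℤ² conformal rectangles converge to
f(cross-ratio) then f = F on (0,1). Proof: for η ∈ (0,1) and the exhausting Jordan domains D_ρ ⊂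
half-strip with bottom marks ξ^(ρ) chosen so that crossRatio = η exactly (intermediate value;
explicit maps as in HalfStripCardyT), f(η) = lim_δ P_(D_ρ)(δ) along δ = 1/N is within e^(−cK(ρ))
(rsw_half_holds, proved) + o(1) of the half-strip limit F(η_∞(ξ^(ρ))) → F(η) (continuity of F).
Elementary but needs explicit ConformalRectangle structures on D_ρ and G02-discretisation
bookkeeping. [difficulty: L] -/
@[route_item "route-CriticalPhenomena-CardyPerronTeleport", crux]
def HalfStripRigidity : Prop :=
  (∀ ξ : Fin 4 → ℝ, StrictMono ξ → 0 ≤ ξ 0 → ξ 3 ≤ 1 → Filter.Tendsto (fun N : ℕ => (Literature.Probability.Percolation.bondPercolation (Literature.Probability.LatticeModels.zdGraph 2) Literature.Probability.Percolation.half).real (Literature.Probability.Percolation.openCrossing {v : Literature.Probability.LatticeModels.Site 2 | 0 ≤ v 0 ∧ v 0 ≤ (N : ℤ) ∧ 0 ≤ v 1} {v : Literature.Probability.LatticeModels.Site 2 | v 1 = 0 ∧ ((⌊ξ 0 * (N : ℝ)⌋₊ : ℕ) : ℤ) ≤ v 0 ∧ v 0 ≤ ((⌊ξ 1 * (N : ℝ)⌋₊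 : ℕ) : ℤ)} {v : Literature.Probability.LatticeModels.Site 2 | v 1 = 0 ∧ ((⌊ξ 2 * (N : ℝ)⌋₊ : ℕ) : ℤ) ≤ v 0 ∧ v 0 ≤ ((⌊ξ 3 * (N : ℝ)⌋₊ : ℕ) : ℤ)})) Filter.atTop (nhds (Literature.Probability.RandomPlanarGeometry.cardyFunction (Literature.Probability.RandomPlanarGeometry.crossRatio (fun i => - Real.cos (Real.pi * ξ i)))))) → ∀ f : ℝ → ℝ, (∀ R : Literature.Probability.RandomPlanarGeometry.ConformalRectangle, R.HasCrossingLimit (Literature.Probability.Percolation.bondDomainCrossingProb R) f) → Set.EqOn f Literature.Probability.RandomPlanarGeometry.cardyFunction (Set.Ioo 0 1)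

/-- item stmt-CriticalPhenomena-14405 · support · rank 10 · closed · proved by Summit.CriticalPhenomena.CardyFormulaZ2.Cruxes.HalfPlaneMarkDensityLaw.SketchLine.halfStripGlue (prover) · by planner
[support] glue Crux → Target (route-choice repair 2026-08-16, target reachability): the rank-2 crux
HalfStripUniversality (bond-ℤ² and site-𝕋 half-strip end crossing probabilities differ by o(1)) and
the support HalfStripCardyT (Smirnov ⇒ the site-𝕋 half-strip end crossing probability tends to
F(crossRatio(−cos πξᵢ))) give the target HalfStripCardyZ2. Proof (provable now, 5 lines, checked
sorry-free in the planner's Sketch.lean): for each admissible ξ, feed HalfStripCardyT the PROVED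
discharge Literature.Probability.Percolation.hasCrossingLimit_triDomainCrossingProb_holds
(Smirnov2001 Thm 1 = Bollobás–Riordan 2006 Ch. 7, in the tree), then P^ℤ²_N = (P^ℤ²_N − P^𝕋_N) +
P^𝕋_N → 0 + F by Filter.Tendsto.add and simp only [sub_add_cancel, zero_add]. This is the item that
CONCLUDES the target, so the item graph reads cruxes → HalfStripCardyZ2 → (closes) CardyFormulaZ2;
the deciding theorem closes (HalfStripCardyZ2 → UniqueConformalLimit → HalfStripRigidity →
CardyFormulaZ2) is unchanged. Rank 10 rather than 9 only so that the gate renders this decl after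
the rank-9 supports it mentions (render order = kind, rank, id-string). [deps:
HalfStripUniversality, HalfStripCardyT, HalfStripCardyZ2] -/
@[route_item "route-CriticalPhenomena-CardyPerronTeleport"]
def HalfStripGlue : Prop :=
  HalfStripUniversality → HalfStripCardyT → HalfStripCardyZ2

/-- item stmt-CriticalPhenomena-5182 · assembly · rank 1 · open · by planner
sources: Smirnov2001, Cardy1992
[assembly] HalfStripUniversality → HalfStripCardyT → HalfStripRigidity → UniqueConformalLimit →
(fact hasCrossingLimit_triDomainCrossingProb, Smirnov2001 Thm 1) → CardyFormulaZ2. -/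
@[route_item "route-CriticalPhenomena-CardyPerronTeleport"]
def Assembly : Prop :=
  HalfStripUniversality → HalfStripCardyT → HalfStripRigidity → UniqueConformalLimit → Literature.Probability.Percolation.hasCrossingLimit_triDomainCrossingProb → CardyFormulaZ2

/-! D-0027 §2.1 — DECIDING THEOREM (planner-authored via `route open/edit --closes-file`; by planner-rbadge-CriticalPhenomena-CardyPerronTe-83f36529-g4-0 2026-08-15T16:12:46Z):
its hypotheses are this route's items and its conclusion the sub-problem Statement (glue_lint), and it elaborates with this file. -/

/-- D-0027 §2.1 deciding theorem of route CardyPerronTeleport: the thesis `X = HalfStripCardyZ2 ∧ X_U`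
decides the conjunct. `UniqueConformalLimit` (X_U) gives one limit function `f` of the cross-ratio
for all bond-ℤ² conformal rectangles; the support `HalfStripRigidity` pins `f = F` on `(0,1)` from
the half-strip target `HalfStripCardyZ2`; every uniformizing datum has cross-ratio in `(0,1)`
(`ConformalRectangle.crossRatio_mem_Ioo_of_isUniformizing`, proved), so `f η` rewrites to `F η`.
The cruxes `HalfStripUniversality` (+ `HalfStripCardyT` fed Smirnov's theorem) are the attack on
the target and do not enter the deciding theorem. -/
@[closes "route-CriticalPhenomena-CardyPerronTeleport"] theorem closes (h₀ : HalfStripCardyZ2) (hU : UniqueConformalLimit) (hR : HalfStripRigidity) :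
    _root_.CardyFormulaZ2 := by
  obtain ⟨f, hf⟩ := hU
  intro R φ x hφ
  rw [← hR h₀ f hf
    (Literature.Probability.RandomPlanarGeometry.ConformalRectangle.crossRatio_mem_Ioo_of_isUniformizing hφ)]
  exact hf R φ x hφ

end Summit.CriticalPhenomena.CardyFormulaZ2.Theses.CardyPerronTeleport
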